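import Literature.NumberTheory.LFunctions.WeilTwoPrimeDeflL2Base
import Literature.NumberTheory.LFunctions.WeilBlockRowsPZ
import HarnessLib

/-!
# Deflated two-prime certificate L2: the factored even inverse agrees with `D`, rows 16–23

`WeilCert.checkDnRow` (even block) for certificate L2, by `decide +kernel`. Pure proof file.
-/

noncomputable section

namespace Literature.NumberTheory.LFunctions

set_option maxHeartbeats 0 in
/-- Row 16 of `DnE/LsE` is row 16 of the even `D` (certificate L2). [folklore] -/
theorem checkDnRow0_16_weilCertDeflL2 : weilCertDeflL2Base.checkDnRow weilCertDeflL2DnE weilCertDeflL2LsE 0 16 = true := by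
  decide +kernel

set_option maxHeartbeats 0 in
/-- Row 17 of `DnE/LsE` is row 17 of the even `D` (certificate L2). [folklore] -/
theorem checkDnRow0_17_weilCertDeflL2 : weilCertDeflL2Base.checkDnRow weilCertDeflL2DnE weilCertDeflL2LsE 0 17 = true := by
  decide +kernel

set_option maxHeartbeats 0 in
/-- Row 18 of `DnE/LsE` is row 18 of the even `D` (certificate L2). [folklore] -/
theorem checkDnRow0_18_weilCertDeflL2 : weilCertDeflL2Base.checkDnRow weilCertDeflL2DnE weilCertDeflL2LsE 0 18 = true := by
  decide +kernel

set_option maxHeartbeats 0 in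
/-- Row 19 of `DnE/LsE` is row 19 of the even `D` (certificate L2). [folklore] -/
theorem checkDnRow0_19_weilCertDeflL2 : weilCertDeflL2Base.checkDnRow weilCertDeflL2DnE weilCertDeflL2LsE 0 19 = true := by
  decide +kernel

set_option maxHeartbeats 0 in
/-- Row 20 of `DnE/LsE` is row 20 of the even `D` (certificate L2). [folklore] -/
theorem checkDnRow0_20_weilCertDeflL2 : weilCertDeflL2Base.checkDnRow weilCertDeflL2DnE weilCertDeflL2LsE 0 20 = true := by
  decide +kernel

set_option maxHeartbeats 0 in
/-- Row 21 of `DnE/LsE` is row 21 of the even `D` (certificate L2). [folklore] -/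
theorem checkDnRow0_21_weilCertDeflL2 : weilCertDeflL2Base.checkDnRow weilCertDeflL2DnE weilCertDeflL2LsE 0 21 = true := by
  decide +kernel

set_option maxHeartbeats 0 in
/-- Row 22 of `DnE/LsE` is row 22 of the even `D` (certificate L2). [folklore] -/
theorem checkDnRow0_22_weilCertDeflL2 : weilCertDeflL2Base.checkDnRow weilCertDeflL2DnE weilCertDeflL2LsE 0 22 = true := by
  decide +kernel

set_option maxHeartbeats 0 in
/-- Row 23 of `DnE/LsE` is row 23 of the even `D` (certificate L2). [folklore] -/
theorem checkDnRow0_23_weilCertDeflL2 : weilCertDeflL2Base.checkDnRow weilCertDeflL2DnE weilCertDeflL2LsE 0 23 = true := by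
  decide +kernel


end Literature.NumberTheory.LFunctions
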